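import Mathlib

/-!
# Route FilamentSkeletonRss · crux `CoreGluing` (stmt-NavierStokesRegularity-15401) — line `Sketch`,
# stub `stub_coreAreaFuchsianRigidity`

**Fuchsian rigidity of the linearised core-area equation at a supercritical stagnation point.**

Along a filament with tangential material speed `w` (of class `C¹`) having a stagnation point
`τs` (`w τs = 0`) with supercritical stretching `w' τs > 3/2`, the linearised similarity
core-area equation reads `w a' = (3/2 − w') a`. It is Fuchsian at `τs` with negative indicial
exponent `(3/2 − w'(τs))/w'(τs)`, so every solution on a punctured neighbourhood of `τs` that is
continuous at `τs` vanishes identically near `τs` (the core data at the stagnation point are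
pinned).

Proof (pure real analysis, Mathlib only).
* Local data: near `τs` the slope `w τ/(τ − τs)` lies in `(D/2, 2D)`, `D := w' τs`, and
  `w' τ > (3/2 + D)/2`; hence the coefficient `c τ := (3/2 − w' τ)/w τ` satisfies the Fuchsian
  sign bound `c τ · (τ − τs) ≤ −κ`, `κ := (D − 3/2)/(4D) > 0`, on a punctured ball, where
  moreover `a` is bounded (continuity at `τs`).
* One-sided vanishing: on the right half-ball the weighted energy `h τ := a τ · a τ · (τ − τs)^κ`
  has derivative `a² (τ − τs)^{κ−1} (2 c (τ − τs) + κ) ≤ 0`, so it is antitone, while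
  `h τ ≤ B² (τ − τs)^κ → 0` as `τ ↓ τs`; hence `h ≡ 0`, i.e. `a ≡ 0` there.
* The left half-ball follows by the reflection `τ ↦ 2τs − τ`, and `a τs = 0` by continuity.
-/

set_option linter.dupNamespace false

namespace Summit.NavierStokesRegularity.NavierStokesRegularity.Theorems

open Set Filter MeasureTheory Topology

/-- **One-sided Fuchsian vanishing.** If `a' = c · a` on `(τs, τs + δ)` with the Fuchsian sign
bound `c τ · (τ − τs) ≤ −κ < 0` and `a` is bounded there, then `a ≡ 0` on `(τs, τs + δ)`:
the weighted energy `a² (τ − τs)^κ` is antitone and tends to `0` at `τs⁺`. -/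
theorem coreAreaFuchsian_rightVanishing {a c : ℝ → ℝ} {τs δ κ B : ℝ} (hκ : 0 < κ)
    (hode : ∀ τ ∈ Ioo τs (τs + δ), HasDerivAt a (c τ * a τ) τ)
    (hc : ∀ τ ∈ Ioo τs (τs + δ), c τ * (τ - τs) ≤ -κ)
    (hB : ∀ τ ∈ Ioo τs (τs + δ), |a τ| ≤ B) :
    ∀ τ ∈ Ioo τs (τs + δ), a τ = 0 := by
  set h : ℝ → ℝ := fun τ => a τ * a τ * (τ - τs) ^ κ
  -- derivative of the weighted energy
  have hderiv : ∀ τ ∈ Ioo τs (τs + δ), HasDerivAt h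
      ((c τ * a τ * a τ + a τ * (c τ * a τ)) * (τ - τs) ^ κ
        + a τ * a τ * (1 * κ * (τ - τs) ^ (κ - 1))) τ := by
    intro τ hτ
    have hτ' : τ - τs ≠ 0 := (sub_pos.mpr hτ.1).ne'
    have hlin : HasDerivAt (fun σ : ℝ => σ - τs) 1 τ := (hasDerivAt_id' (x := τ)).sub_const τs
    exact ((hode τ hτ).fun_mul (hode τ hτ)).fun_mul (hlin.rpow_const (Or.inl hτ'))
  -- its sign
  have hnonpos : ∀ τ ∈ Ioo τs (τs + δ),
      (c τ * a τ * a τ + a τ * (c τ * a τ)) * (τ - τs) ^ κ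
        + a τ * a τ * (1 * κ * (τ - τs) ^ (κ - 1)) ≤ 0 := by
    intro τ hτ
    have hd : 0 < τ - τs := sub_pos.mpr hτ.1
    have hsplit : (τ - τs) ^ κ = (τ - τs) ^ (κ - 1) * (τ - τs) := by
      rw [Real.rpow_sub_one hd.ne' κ, div_mul_cancel₀ _ hd.ne']
    have hP : 0 < (τ - τs) ^ (κ - 1) := Real.rpow_pos_of_pos hd _
    calc (c τ * a τ * a τ + a τ * (c τ * a τ)) * (τ - τs) ^ κ
          + a τ * a τ * (1 * κ * (τ - τs) ^ (κ - 1))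
        = a τ * a τ * (τ - τs) ^ (κ - 1) * (2 * (c τ * (τ - τs)) + κ) := by
          rw [hsplit]; ring
      _ ≤ 0 := by
          apply mul_nonpos_of_nonneg_of_nonpos
          · exact mul_nonneg (mul_self_nonneg _) hP.le
          · linarith [hc τ hτ]
  -- hence the weighted energy is antitone on the half-ball
  have hanti : AntitoneOn h (Ioo τs (τs + δ)) := by
    apply antitoneOn_of_deriv_nonpos (convex_Ioo _ _)
    · exact fun τ hτ => (hderiv τ hτ).continuousAt.continuousWithinAt
    · rw [interior_Ioo]
      exact fun τ hτ => (hderiv τ hτ).differentiableAt.differentiableWithinAt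
    · rw [interior_Ioo]
      intro τ hτ
      rw [(hderiv τ hτ).deriv]
      exact hnonpos τ hτ
  -- domination by `B² (τ - τs)^κ → 0`
  have hdom : ∀ τ ∈ Ioo τs (τs + δ), h τ ≤ B * B * (τ - τs) ^ κ := by
    intro τ hτ
    have hd : 0 < τ - τs := sub_pos.mpr hτ.1
    have habs := hB τ hτ
    have hB0 : 0 ≤ B := (abs_nonneg _).trans habs
    have h1 : a τ * a τ ≤ B * B := by
      calc a τ * a τ = |a τ| * |a τ| := (abs_mul_abs_self _).symm
        _ ≤ B * B := mul_le_mul habs habs (abs_nonneg _) hB0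
    exact mul_le_mul_of_nonneg_right h1 (Real.rpow_pos_of_pos hd _).le
  have hlim : Tendsto (fun τ => B * B * (τ - τs) ^ κ) (𝓝[>] τs) (𝓝 0) := by
    have h0 : Tendsto (fun τ : ℝ => τ - τs) (𝓝[>] τs) (𝓝 0) :=
      tendsto_nhdsWithin_of_tendsto_nhds (tendsto_sub_nhds_zero_iff.mpr tendsto_id)
    have := (h0.rpow_const_nhds_zero hκ).const_mul (B * B)
    rwa [mul_zero] at this
  -- conclusion: a nonzero value would make the energy positive, contradicting the limit
  intro τ₁ hτ₁
  by_contra hne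
  have hpos : 0 < h τ₁ :=
    mul_pos (mul_self_pos.mpr hne) (Real.rpow_pos_of_pos (sub_pos.mpr hτ₁.1) _)
  have hev : ∀ᶠ τ in 𝓝[>] τs, B * B * (τ - τs) ^ κ < h τ₁ ∧ τ ∈ Ioo τs τ₁ :=
    (hlim.eventually (eventually_lt_nhds hpos)).and (Ioo_mem_nhdsGT hτ₁.1)
  obtain ⟨τ, hτlt, hτ⟩ := hev.exists
  have hτD : τ ∈ Ioo τs (τs + δ) := ⟨hτ.1, hτ.2.trans hτ₁.2⟩
  have hmono : h τ₁ ≤ h τ := hanti hτD hτ₁ hτ.2.le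
  linarith [hdom τ hτD]

/-- **Local Fuchsian data.** Under the hypotheses of the stub, on a punctured ball around `τs`
the solution satisfies `a' = c a` with `c τ := (3/2 − w' τ)/w τ`, the Fuchsian sign bound
`c τ · (τ − τs) ≤ −κ < 0` holds, and `a` is bounded. -/
theorem coreAreaFuchsian_localData {w a : ℝ → ℝ} {τs : ℝ} (hw : ContDiff ℝ 1 w)
    (hw0 : w τs = 0) (hws : 3 / 2 < deriv w τs) (ha : ContinuousAt a τs)
    (hode : ∀ᶠ τ in 𝓝 τs, τ ≠ τs → HasDerivAt a ((3 / 2 - deriv w τ) * a τ / w τ) τ) :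
    ∃ ε > 0, ∃ κ > 0, ∃ B : ℝ, ∀ τ, |τ - τs| < ε → τ ≠ τs →
      HasDerivAt a ((3 / 2 - deriv w τ) / w τ * a τ) τ ∧
        (3 / 2 - deriv w τ) / w τ * (τ - τs) ≤ -κ ∧ |a τ| ≤ B := by
  set D := deriv w τs with hD_def
  have hD : 0 < D := by linarith
  -- the slope of `w` at `τs` tends to `D`
  have hslope : Tendsto (slope w τs) (𝓝[≠] τs) (𝓝 D) :=
    hasDerivAt_iff_tendsto_slope.mp ((hw.differentiable one_ne_zero) τs).hasDerivAt
  have h1 : ∀ᶠ τ in 𝓝[≠] τs, slope w τs τ ∈ Ioo (D / 2) (2 * D) :=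
    hslope.eventually_mem (Ioo_mem_nhds (by linarith) (by linarith))
  have h2 : ∀ᶠ τ in 𝓝 τs, deriv w τ ∈ Ioi ((3 / 2 + D) / 2) :=
    hw.continuous_deriv_one.continuousAt.eventually_mem (Ioi_mem_nhds (by linarith))
  have h3 : ∀ᶠ τ in 𝓝 τs, a τ ∈ Ioo (a τs - 1) (a τs + 1) :=
    ha.eventually_mem (Ioo_mem_nhds (by linarith) (by linarith))
  have hall := h1.and ((h2.and (h3.and hode)).filter_mono nhdsWithin_le_nhds)
  rw [eventually_nhdsWithin_iff, Metric.eventually_nhds_iff] at hall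
  obtain ⟨ε, hε, hball⟩ := hall
  set κ := (D - 3 / 2) / (4 * D) with hκ_def
  have hκ : 0 < κ := div_pos (by linarith) (by linarith)
  refine ⟨ε, hε, κ, hκ, |a τs| + 1, fun τ hτ hne => ?_⟩
  have hτd : dist τ τs < ε := by rwa [Real.dist_eq]
  have hτ' : τ - τs ≠ 0 := sub_ne_zero.mpr hne
  obtain ⟨hsl, hdw, haτ, hode'⟩ := hball hτd hne
  rw [mem_Ioo, slope_def_field, hw0, sub_zero] at hsl
  rw [mem_Ioi] at hdw
  -- `q` = slope, `w τ = q (τ - τs)` with `D/2 < q < 2D`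
  set q := w τ / (τ - τs) with hq_def
  have hqpos : 0 < q := by linarith [hsl.1]
  have hwq : w τ = q * (τ - τs) := by rw [hq_def, div_mul_cancel₀ _ hτ']
  have hcq : (3 / 2 - deriv w τ) / w τ * (τ - τs) = (3 / 2 - deriv w τ) / q := by
    rw [hwq, div_mul_eq_mul_div, mul_div_mul_right _ _ hτ']
  have hκq : κ * q < (D - 3 / 2) / 2 := by
    calc κ * q < κ * (2 * D) := mul_lt_mul_of_pos_left hsl.2 hκ
      _ = (D - 3 / 2) / 2 := by
          rw [hκ_def, div_mul_eq_mul_div, div_eq_div_iff (by positivity) two_ne_zero]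
          ring
  refine ⟨(hode' hne).congr_deriv (by ring), ?_, ?_⟩
  · rw [hcq, div_le_iff₀ hqpos, neg_mul]
    linarith
  · exact abs_le.mpr
      ⟨by linarith [haτ.1, neg_abs_le (a τs)], by linarith [haτ.2, le_abs_self (a τs)]⟩

/-- **Fuchsian rigidity of the linearised core-area equation.** Let `w ∈ C¹(ℝ)` with
`w τs = 0` and `w' τs > 3/2`, and let `a` be continuous at `τs` and solve the linearised
core-area equation `a' = (3/2 − w') a / w` on a punctured neighbourhood of `τs`. Then `a`
vanishes identically on a neighbourhood of `τs`. -/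
theorem stub_coreAreaFuchsianRigidity : ∀ (w a : ℝ → ℝ) (τs : ℝ), ContDiff ℝ 1 w → w τs = 0 → 3 / 2 < deriv w τs → ContinuousAt a τs → (∀ᶠ τ in 𝓝 τs, τ ≠ τs → HasDerivAt a ((3 / 2 - deriv w τ) * a τ / w τ) τ) → ∀ᶠ τ in 𝓝 τs, a τ = 0 := by
  intro w a τs hw hw0 hws ha hode
  obtain ⟨ε, hε, κ, hκ, B, hball⟩ := coreAreaFuchsian_localData hw hw0 hws ha hode
  -- the Fuchsian coefficient
  set c : ℝ → ℝ := fun τ => (3 / 2 - deriv w τ) / w τ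
  have hpunct : ∀ τ, |τ - τs| < ε → τ ≠ τs →
      HasDerivAt a (c τ * a τ) τ ∧ c τ * (τ - τs) ≤ -κ ∧ |a τ| ≤ B := hball
  -- right half-ball
  have hmemR : ∀ τ ∈ Ioo τs (τs + ε), |τ - τs| < ε ∧ τ ≠ τs := fun τ hτ =>
    ⟨abs_sub_lt_iff.mpr ⟨by linarith [hτ.2], by linarith [hτ.1]⟩, ne_of_gt hτ.1⟩
  have hright : ∀ τ ∈ Ioo τs (τs + ε), a τ = 0 :=
    coreAreaFuchsian_rightVanishing hκ
      (fun τ hτ => (hpunct τ (hmemR τ hτ).1 (hmemR τ hτ).2).1)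
      (fun τ hτ => (hpunct τ (hmemR τ hτ).1 (hmemR τ hτ).2).2.1)
      (fun τ hτ => (hpunct τ (hmemR τ hτ).1 (hmemR τ hτ).2).2.2)
  -- left half-ball, by the reflection `σ = 2 τs - τ`
  have hmemL : ∀ τ ∈ Ioo τs (τs + ε), |2 * τs - τ - τs| < ε ∧ 2 * τs - τ ≠ τs := fun τ hτ =>
    ⟨abs_sub_lt_iff.mpr ⟨by linarith [hτ.1], by linarith [hτ.2]⟩, by intro h; linarith [hτ.1]⟩
  have hL1 : ∀ τ ∈ Ioo τs (τs + ε),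
      HasDerivAt (fun σ => a (2 * τs - σ)) (-c (2 * τs - τ) * a (2 * τs - τ)) τ := by
    intro τ hτ
    have hσ := (hpunct (2 * τs - τ) (hmemL τ hτ).1 (hmemL τ hτ).2).1
    have hlin : HasDerivAt (fun σ : ℝ => 2 * τs - σ) (-1) τ :=
      (hasDerivAt_id' (x := τ)).const_sub (2 * τs)
    exact (hσ.comp τ hlin).congr_deriv (by ring)
  have hL2 : ∀ τ ∈ Ioo τs (τs + ε), -c (2 * τs - τ) * (τ - τs) ≤ -κ := by
    intro τ hτ
    have hσ := (hpunct (2 * τs - τ) (hmemL τ hτ).1 (hmemL τ hτ).2).2.1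
    have : -c (2 * τs - τ) * (τ - τs) = c (2 * τs - τ) * (2 * τs - τ - τs) := by ring
    linarith
  have hL3 : ∀ τ ∈ Ioo τs (τs + ε), |a (2 * τs - τ)| ≤ B := fun τ hτ =>
    (hpunct (2 * τs - τ) (hmemL τ hτ).1 (hmemL τ hτ).2).2.2
  have hrefl : ∀ τ ∈ Ioo τs (τs + ε), a (2 * τs - τ) = 0 :=
    coreAreaFuchsian_rightVanishing (a := fun σ => a (2 * τs - σ))
      (c := fun σ => -c (2 * τs - σ)) hκ hL1 hL2 hL3
  have hleft : ∀ τ ∈ Ioo (τs - ε) τs, a τ = 0 := by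
    intro τ hτ
    have := hrefl (2 * τs - τ) ⟨by linarith [hτ.2], by linarith [hτ.1]⟩
    rwa [show 2 * τs - (2 * τs - τ) = τ by ring] at this
  -- centre, by continuity
  have hcenter : a τs = 0 := by
    have h1 : Tendsto a (𝓝[>] τs) (𝓝 (a τs)) := ha.tendsto.mono_left nhdsWithin_le_nhds
    have h2 : Tendsto a (𝓝[>] τs) (𝓝 0) := by
      refine tendsto_const_nhds.congr' ?_
      filter_upwards [Ioo_mem_nhdsGT (show τs < τs + ε by linarith)] with τ hτ
      exact (hright τ hτ).symm
    exact tendsto_nhds_unique h1 h2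
  -- assemble
  rw [Metric.eventually_nhds_iff]
  refine ⟨ε, hε, fun τ hτ => ?_⟩
  rw [Real.dist_eq] at hτ
  rcases lt_trichotomy τ τs with hlt | heq | hgt
  · exact hleft τ ⟨by linarith [(abs_lt.mp hτ).1], hlt⟩
  · rw [heq]; exact hcenter
  · exact hright τ ⟨hgt, by linarith [(abs_lt.mp hτ).2]⟩

end Summit.NavierStokesRegularity.NavierStokesRegularity.Theorems
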